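import Mathlib
import HarnessLib
import Summits.AtomisticToContinuum.FouriersLaw.Theorems.JunctionLocalityConductanceLowerBoundStubShortTimeDipoleFloorAux5
import Summits.AtomisticToContinuum.FouriersLaw.Theorems.JunctionLocalityConductanceLowerBoundStubShortTimeDipoleFloorAux8
import Summits.AtomisticToContinuum.FouriersLaw.Theorems.JunctionLocalityConductanceLowerBoundStubShortTimeDipoleFloorAux9
import Summits.AtomisticToContinuum.FouriersLaw.Theorems.JunctionLocalityConductanceLowerBoundStubShortTimeDipoleFloorAux10

/-!
# Short-time dipole floor, helper 11: annealed moments of the light-cone factors (Gibbs ⊗ Wiener)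

Helper (`--supports stmt-AtomisticToContinuum-11749`) for stub `stub_shortTimeDipoleFloor` (S) of line
`kick-dipole-no-collapse`, crux `JunctionLocality.ConductanceLowerBound`.

Under the stationary law `π = μ_T ⊗ W` of the pinned anharmonic chain (both baths at `T`), with constants depending only on
`(ω₂, lam, β, γ, T)` — NOT on `N`, the bond or the site:
* `lintegral_bondScalar_pow_le` — every power `≤ 16` of the bond scalar `E_k = 1 + q_k² + q_{k+1}² + p_k² + p_{k+1}²`, read at
  time `0`, along the flow at time `s`, or along the flipped flow, has `∫⁻ E_k^a dπ ≤ K`;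
* `lintegral_prefactor_sq_le` — the squared prefactor `G² = (c_j |a₀| 2|p_0| E_k(Φ_s)² E_k(Φ'_s)²)²` has `∫⁻ G² dπ ≤ K_G`;
* `helper_kdPrefactorMoments` — the registered closed form.
-/

noncomputable section

open MeasureTheory ProbabilityTheory Set Filter Topology Finset
open scoped NNReal ENNReal

namespace Summit.AtomisticToContinuum.FouriersLaw.Cruxes.ConductanceLowerBound.KickDipoleNoCollapse

open Literature.MathematicalPhysics.KineticTheory Literature.MathematicalPhysics.KineticTheory.HeatConduction
open Literature.Probability.Process OscillatorChain
open Summit.AtomisticToContinuum.FouriersLaw.Theorems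
open Summit.AtomisticToContinuum.FouriersLaw.Theorems.NonBallistic

variable {ω₂ lam β γ : ℝ} (hω : 0 < ω₂) (hl : 0 ≤ lam) (hβ : 0 ≤ β) (hγ : 0 ≤ γ) {T : ℝ} (hT : 0 < T)

/-! ### The bond scalar under the Gibbs state -/

/-- Pointwise: `E^a ≤ 5^16 (1 + q_k^32 + q_l^32 + p_k^32 + p_l^32)` for the bond scalar `E = 1 + q_k² + q_l² + p_k² + p_l²`
and `a ≤ 16`. -/
theorem bondScalar_pow_le (qk ql pk pl : ℝ) {a : ℕ} (ha : a ≤ 16) :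
    (1 + qk ^ 2 + ql ^ 2 + pk ^ 2 + pl ^ 2) ^ a ≤
      5 ^ 16 * (1 + qk ^ (2 * 16) + ql ^ (2 * 16) + pk ^ (2 * 16) + pl ^ (2 * 16)) := by
  have hE1 : 1 ≤ 1 + qk ^ 2 + ql ^ 2 + pk ^ 2 + pl ^ 2 := by nlinarith [sq_nonneg qk, sq_nonneg ql, sq_nonneg pk, sq_nonneg pl]
  calc (1 + qk ^ 2 + ql ^ 2 + pk ^ 2 + pl ^ 2) ^ a ≤ (1 + qk ^ 2 + ql ^ 2 + pk ^ 2 + pl ^ 2) ^ 16 :=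
        pow_le_pow_right₀ hE1 ha
    _ ≤ 5 ^ 16 * (1 ^ 16 + (qk ^ 2) ^ 16 + (ql ^ 2) ^ 16 + (pk ^ 2) ^ 16 + (pl ^ 2) ^ 16) :=
        add_five_pow_le zero_le_one (sq_nonneg _) (sq_nonneg _) (sq_nonneg _) (sq_nonneg _) 16
    _ = _ := by rw [one_pow, ← pow_mul, ← pow_mul, ← pow_mul, ← pow_mul]

include hω hl hβ hT in
/-- **`N`-uniform moments of the bond scalar** under the Gibbs state: there is `K` with `∫ E_k^a dμ_T^N ≤ K` (and integrability)
for every `N`, every pair of sites `k, l` and every `a ≤ 16`. -/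
theorem exists_bondScalar_moment_bound : ∃ K : ℝ, 1 ≤ K ∧ ∀ (N : ℕ) (k l : Fin N) (a : ℕ), a ≤ 16 →
    Integrable (fun z : PhaseSpace N => (1 + z.1 k ^ 2 + z.1 l ^ 2 + z.2 k ^ 2 + z.2 l ^ 2) ^ a) ((pinnedChain ω₂ lam β γ).gibbsMeasure N T) ∧
    ∫ z, (1 + z.1 k ^ 2 + z.1 l ^ 2 + z.2 k ^ 2 + z.2 l ^ 2) ^ a ∂((pinnedChain ω₂ lam β γ).gibbsMeasure N T) ≤ K := by
  obtain ⟨C, A, hC1, hA0, hmom⟩ := helper_kdGibbsFactorialMoments ω₂ lam β γ hω hl hβ T hT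
  set M : ℝ := C * (A * 16) ^ 16 with hM
  have hM0 : 0 ≤ M := by positivity
  refine ⟨5 ^ 16 * (1 + 4 * M), ?_, fun N k l a ha => ?_⟩
  · have : (1:ℝ) ≤ 5 ^ 16 := by norm_num
    nlinarith
  set P := pinnedChain ω₂ lam β γ with hP
  haveI : IsProbabilityMeasure (P.gibbsMeasure N T) := pinnedChain_isProbabilityMeasure_gibbsMeasure hω hl hβ γ N hT
  obtain ⟨hqk, hqk', -, -⟩ := hmom N k 16
  obtain ⟨hql, hql', -, -⟩ := hmom N l 16
  obtain ⟨-, -, hpk, hpk'⟩ := hmom N k 16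
  obtain ⟨-, -, hpl, hpl'⟩ := hmom N l 16
  have hmaj : Integrable (fun z : PhaseSpace N => (5:ℝ) ^ 16 * (1 + z.1 k ^ (2 * 16) + z.1 l ^ (2 * 16) + z.2 k ^ (2 * 16) + z.2 l ^ (2 * 16)))
      (P.gibbsMeasure N T) := (((((integrable_const 1).add hqk).add hql).add hpk).add hpl).const_mul _
  have hpt : ∀ z : PhaseSpace N, (1 + z.1 k ^ 2 + z.1 l ^ 2 + z.2 k ^ 2 + z.2 l ^ 2) ^ a ≤
      (5:ℝ) ^ 16 * (1 + z.1 k ^ (2 * 16) + z.1 l ^ (2 * 16) + z.2 k ^ (2 * 16) + z.2 l ^ (2 * 16)) := fun z =>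
    bondScalar_pow_le _ _ _ _ ha
  have hnn : ∀ z : PhaseSpace N, 0 ≤ (1 + z.1 k ^ 2 + z.1 l ^ 2 + z.2 k ^ 2 + z.2 l ^ 2) ^ a := fun z => by positivity
  have hint : Integrable (fun z : PhaseSpace N => (1 + z.1 k ^ 2 + z.1 l ^ 2 + z.2 k ^ 2 + z.2 l ^ 2) ^ a) (P.gibbsMeasure N T) :=
    hmaj.mono' (by fun_prop) (ae_of_all _ fun z => by rw [Real.norm_eq_abs, abs_of_nonneg (hnn z)]; exact hpt z)
  refine ⟨hint, (integral_mono hint hmaj hpt).trans ?_⟩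
  have h16 : ((16 : ℕ) : ℝ) = 16 := by norm_num
  rw [h16] at hqk' hql' hpk' hpl'
  have i1 : Integrable (fun z : PhaseSpace N => (1:ℝ) + z.1 k ^ (2 * 16)) (P.gibbsMeasure N T) := (integrable_const 1).add hqk
  have i2 : Integrable (fun z : PhaseSpace N => (1:ℝ) + z.1 k ^ (2 * 16) + z.1 l ^ (2 * 16)) (P.gibbsMeasure N T) := i1.add hql
  have i3 : Integrable (fun z : PhaseSpace N => (1:ℝ) + z.1 k ^ (2 * 16) + z.1 l ^ (2 * 16) + z.2 k ^ (2 * 16)) (P.gibbsMeasure N T) :=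
    i2.add hpk
  have e : ∫ z, (1:ℝ) + z.1 k ^ (2 * 16) + z.1 l ^ (2 * 16) + z.2 k ^ (2 * 16) + z.2 l ^ (2 * 16) ∂(P.gibbsMeasure N T) =
      1 + ∫ z, z.1 k ^ (2 * 16) ∂(P.gibbsMeasure N T) + ∫ z, z.1 l ^ (2 * 16) ∂(P.gibbsMeasure N T) +
        ∫ z, z.2 k ^ (2 * 16) ∂(P.gibbsMeasure N T) + ∫ z, z.2 l ^ (2 * 16) ∂(P.gibbsMeasure N T) := by
    rw [integral_add i3 hpl, integral_add i2 hpk, integral_add i1 hql, integral_add (integrable_const 1) hqk]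
    simp [Measure.real]
  rw [integral_const_mul, e]
  have : ∫ z, z.1 k ^ (2 * 16) ∂(P.gibbsMeasure N T) + ∫ z, z.1 l ^ (2 * 16) ∂(P.gibbsMeasure N T) +
      ∫ z, z.2 k ^ (2 * 16) ∂(P.gibbsMeasure N T) + ∫ z, z.2 l ^ (2 * 16) ∂(P.gibbsMeasure N T) ≤ 4 * M := by linarith
  nlinarith

include hω hl hβ hγ hT in
/-- **Bond-scalar moments along the stationary flows.**  With `K` from `exists_bondScalar_moment_bound`: for `N ≥ 1`, sites
`k, l, i₀`, every real time `r` and `a ≤ 16`, the `π = μ_T ⊗ W` lower integrals of `E_{k,l}^a` read at the start `x`, along the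
flow `Φ_r(x)` and along the flipped flow `Φ_r(x^{i₀})` are all `≤ K` (stationarity from both starts). -/
theorem lintegral_bondScalar_pow_le {K : ℝ}
    (hK : ∀ (N : ℕ) (k l : Fin N) (a : ℕ), a ≤ 16 →
      Integrable (fun z : PhaseSpace N => (1 + z.1 k ^ 2 + z.1 l ^ 2 + z.2 k ^ 2 + z.2 l ^ 2) ^ a) ((pinnedChain ω₂ lam β γ).gibbsMeasure N T) ∧
      ∫ z, (1 + z.1 k ^ 2 + z.1 l ^ 2 + z.2 k ^ 2 + z.2 l ^ 2) ^ a ∂((pinnedChain ω₂ lam β γ).gibbsMeasure N T) ≤ K)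
    {N : ℕ} (hN : 0 < N) (k l i₀ : Fin N) (r : ℝ) {a : ℕ} (ha : a ≤ 16) :
    ∫⁻ q, ENNReal.ofReal ((1 + q.1.1 k ^ 2 + q.1.1 l ^ 2 + q.1.2 k ^ 2 + q.1.2 l ^ 2) ^ a)
        ∂(((pinnedChain ω₂ lam β γ).gibbsMeasure N T).prod wienerPair) ≤ ENNReal.ofReal K ∧
    ∫⁻ q, ENNReal.ofReal ((1 + ((pinnedChain ω₂ lam β γ).solMap N T T r q.1 (pairPath q.2)).1 k ^ 2 +
        ((pinnedChain ω₂ lam β γ).solMap N T T r q.1 (pairPath q.2)).1 l ^ 2 +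
        ((pinnedChain ω₂ lam β γ).solMap N T T r q.1 (pairPath q.2)).2 k ^ 2 +
        ((pinnedChain ω₂ lam β γ).solMap N T T r q.1 (pairPath q.2)).2 l ^ 2) ^ a)
        ∂(((pinnedChain ω₂ lam β γ).gibbsMeasure N T).prod wienerPair) ≤ ENNReal.ofReal K ∧
    ∫⁻ q, ENNReal.ofReal ((1 + ((pinnedChain ω₂ lam β γ).solMap N T T r (momentumFlip i₀ q.1) (pairPath q.2)).1 k ^ 2 +
        ((pinnedChain ω₂ lam β γ).solMap N T T r (momentumFlip i₀ q.1) (pairPath q.2)).1 l ^ 2 +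
        ((pinnedChain ω₂ lam β γ).solMap N T T r (momentumFlip i₀ q.1) (pairPath q.2)).2 k ^ 2 +
        ((pinnedChain ω₂ lam β γ).solMap N T T r (momentumFlip i₀ q.1) (pairPath q.2)).2 l ^ 2) ^ a)
        ∂(((pinnedChain ω₂ lam β γ).gibbsMeasure N T).prod wienerPair) ≤ ENNReal.ofReal K := by
  set P := pinnedChain ω₂ lam β γ with hP
  set μ := P.gibbsMeasure N T with hμ
  haveI : IsProbabilityMeasure μ := pinnedChain_isProbabilityMeasure_gibbsMeasure hω hl hβ γ N hT
  set g : PhaseSpace N → ℝ≥0∞ := fun z => ENNReal.ofReal ((1 + z.1 k ^ 2 + z.1 l ^ 2 + z.2 k ^ 2 + z.2 l ^ 2) ^ a) with hg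
  have hgm : Measurable g := by simp only [hg]; fun_prop
  obtain ⟨hint, hle⟩ := hK N k l a ha
  have hval : ∫⁻ z, g z ∂μ ≤ ENNReal.ofReal K := by
    rw [hg, ← ofReal_integral_eq_lintegral_ofReal hint (ae_of_all _ fun z => by positivity)]
    exact ENNReal.ofReal_le_ofReal hle
  refine ⟨?_, ?_, ?_⟩
  · have hm : Measurable fun q : PhaseSpace N × WienerPair => g q.1 := hgm.comp measurable_fst
    calc ∫⁻ q, g q.1 ∂(μ.prod wienerPair) = ∫⁻ x, ∫⁻ _ω, g x ∂wienerPair ∂μ := lintegral_prod _ hm.aemeasurable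
      _ = ∫⁻ x, g x ∂μ := lintegral_congr fun x => by rw [lintegral_const, measure_univ, mul_one]
      _ ≤ ENNReal.ofReal K := hval
  · exact (pinnedChain_lintegral_prod_solMap_gibbs hω hl hβ hγ N hN hT r hgm).le.trans hval
  · exact (lintegral_prod_solMap_flip_gibbs hω hl hβ hγ N hN hT i₀ r hgm).le.trans hval

/-- `xy ≤ (x² + y²)/2`-type splitting for the prefactor: `A⁸ B⁴ C⁴ ≤ (2A^16 + B^16 + C^16)/4`
(from `2 A⁸ (B⁴C⁴) ≤ A^16 + B⁸C⁸` and `2 B⁸ C⁸ ≤ B^16 + C^16`). -/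
theorem prefactor_split {A B C : ℝ} (_hA : 0 ≤ A) (_hB : 0 ≤ B) (_hC : 0 ≤ C) :
    A ^ 8 * B ^ 4 * C ^ 4 ≤ (2 * A ^ 16 + B ^ 16 + C ^ 16) / 4 := by
  have h1 : 2 * (A ^ 8 * (B ^ 4 * C ^ 4)) ≤ A ^ 16 + (B ^ 4 * C ^ 4) ^ 2 := by nlinarith [sq_nonneg (A ^ 8 - B ^ 4 * C ^ 4)]
  have h2 : 2 * (B ^ 8 * C ^ 8) ≤ B ^ 16 + C ^ 16 := by nlinarith [sq_nonneg (B ^ 8 - C ^ 8)]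
  have e : (B ^ 4 * C ^ 4) ^ 2 = B ^ 8 * C ^ 8 := by ring
  nlinarith

/-- **The squared prefactor, abstract core.**  On any measure space: if `|a| ≤ c_a E₀³`, `|p| ≤ E₀`, `E₀ ≥ 1`, `E, E' ≥ 0` and
the sixteenth moments of `E₀, E, E'` are `≤ K`, then `∫⁻ (c_j |a| 2|p| E² E'²)² ≤ 4 c_j² c_a² K`
(`E₀⁸ E⁴ E'⁴ ≤ (2E₀^16 + E^16 + E'^16)/4`). -/
theorem lintegral_prefactor_sq_le_abstract {Ω : Type*} [MeasurableSpace Ω] (π : Measure Ω) {cj ca K : ℝ}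
    (hcj : 0 ≤ cj) (hca : 0 ≤ ca) (hK0 : 0 ≤ K) {a p E0 Es Es' : Ω → ℝ}
    (hE0m : Measurable E0) (hEsm : Measurable Es) (hEs'm : Measurable Es')
    (hE01 : ∀ q, 1 ≤ E0 q) (hEs0 : ∀ q, 0 ≤ Es q) (hEs'0 : ∀ q, 0 ≤ Es' q)
    (hap : ∀ q, |a q| ≤ ca * E0 q ^ 3) (hp : ∀ q, |p q| ≤ E0 q)
    (h0 : ∫⁻ q, ENNReal.ofReal (E0 q ^ 16) ∂π ≤ ENNReal.ofReal K)
    (hs : ∫⁻ q, ENNReal.ofReal (Es q ^ 16) ∂π ≤ ENNReal.ofReal K)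
    (hs' : ∫⁻ q, ENNReal.ofReal (Es' q ^ 16) ∂π ≤ ENNReal.ofReal K) :
    ∫⁻ q, ENNReal.ofReal ((cj * |a q| * (2 * |p q|) * Es q ^ 2 * Es' q ^ 2) ^ 2) ∂π ≤
      ENNReal.ofReal (4 * cj ^ 2 * ca ^ 2 * K) := by
  have hE00 : ∀ q, 0 ≤ E0 q := fun q => zero_le_one.trans (hE01 q)
  -- pointwise domination of `G²`
  have hpt : ∀ q, ENNReal.ofReal ((cj * |a q| * (2 * |p q|) * Es q ^ 2 * Es' q ^ 2) ^ 2) ≤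
      ENNReal.ofReal (cj ^ 2 * ca ^ 2) * (2 * ENNReal.ofReal (E0 q ^ 16) + ENNReal.ofReal (Es q ^ 16) +
        ENNReal.ofReal (Es' q ^ 16)) := by
    intro q
    have hG : cj * |a q| * (2 * |p q|) * Es q ^ 2 * Es' q ^ 2 ≤ 2 * cj * ca * (E0 q ^ 4 * Es q ^ 2 * Es' q ^ 2) := by
      have h1 : |a q| * (2 * |p q|) ≤ (ca * E0 q ^ 3) * (2 * E0 q) :=
        mul_le_mul (hap q) (by linarith [hp q]) (by positivity) (by have := hE00 q; positivity)
      have h2 : 0 ≤ Es q ^ 2 * Es' q ^ 2 := by positivity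
      calc cj * |a q| * (2 * |p q|) * Es q ^ 2 * Es' q ^ 2 = cj * (|a q| * (2 * |p q|)) * (Es q ^ 2 * Es' q ^ 2) := by ring
        _ ≤ cj * ((ca * E0 q ^ 3) * (2 * E0 q)) * (Es q ^ 2 * Es' q ^ 2) :=
            mul_le_mul_of_nonneg_right (mul_le_mul_of_nonneg_left h1 hcj) h2
        _ = 2 * cj * ca * (E0 q ^ 4 * Es q ^ 2 * Es' q ^ 2) := by ring
    have hG0 : 0 ≤ cj * |a q| * (2 * |p q|) * Es q ^ 2 * Es' q ^ 2 := by positivity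
    have hsp := prefactor_split (hE00 q) (hEs0 q) (hEs'0 q)
    have hreal : (cj * |a q| * (2 * |p q|) * Es q ^ 2 * Es' q ^ 2) ^ 2 ≤
        cj ^ 2 * ca ^ 2 * (2 * E0 q ^ 16 + Es q ^ 16 + Es' q ^ 16) :=
      calc (cj * |a q| * (2 * |p q|) * Es q ^ 2 * Es' q ^ 2) ^ 2
          ≤ (2 * cj * ca * (E0 q ^ 4 * Es q ^ 2 * Es' q ^ 2)) ^ 2 := pow_le_pow_left₀ hG0 hG 2
        _ = 4 * cj ^ 2 * ca ^ 2 * (E0 q ^ 8 * Es q ^ 4 * Es' q ^ 4) := by ring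
        _ ≤ 4 * cj ^ 2 * ca ^ 2 * ((2 * E0 q ^ 16 + Es q ^ 16 + Es' q ^ 16) / 4) :=
            mul_le_mul_of_nonneg_left hsp (by positivity)
        _ = cj ^ 2 * ca ^ 2 * (2 * E0 q ^ 16 + Es q ^ 16 + Es' q ^ 16) := by ring
    calc ENNReal.ofReal ((cj * |a q| * (2 * |p q|) * Es q ^ 2 * Es' q ^ 2) ^ 2)
        ≤ ENNReal.ofReal (cj ^ 2 * ca ^ 2 * (2 * E0 q ^ 16 + Es q ^ 16 + Es' q ^ 16)) := ENNReal.ofReal_le_ofReal hreal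
      _ = _ := by
          rw [ENNReal.ofReal_mul (by positivity), ENNReal.ofReal_add (by positivity) (by positivity),
            ENNReal.ofReal_add (by positivity) (by positivity), ENNReal.ofReal_mul zero_le_two, ENNReal.ofReal_ofNat]
  have m1 : Measurable fun q => ENNReal.ofReal (E0 q ^ 16) := (hE0m.pow_const 16).ennreal_ofReal
  have m2 : Measurable fun q => ENNReal.ofReal (Es q ^ 16) := (hEsm.pow_const 16).ennreal_ofReal
  have m3 : Measurable fun q => ENNReal.ofReal (Es' q ^ 16) := (hEs'm.pow_const 16).ennreal_ofReal
  have m12 : Measurable fun q => 2 * ENNReal.ofReal (E0 q ^ 16) + ENNReal.ofReal (Es q ^ 16) := (m1.const_mul 2).add m2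
  have m123 : Measurable fun q => 2 * ENNReal.ofReal (E0 q ^ 16) + ENNReal.ofReal (Es q ^ 16) + ENNReal.ofReal (Es' q ^ 16) :=
    m12.add m3
  calc ∫⁻ q, ENNReal.ofReal ((cj * |a q| * (2 * |p q|) * Es q ^ 2 * Es' q ^ 2) ^ 2) ∂π
      ≤ ∫⁻ q, ENNReal.ofReal (cj ^ 2 * ca ^ 2) * (2 * ENNReal.ofReal (E0 q ^ 16) + ENNReal.ofReal (Es q ^ 16) +
          ENNReal.ofReal (Es' q ^ 16)) ∂π := lintegral_mono hpt
    _ = ENNReal.ofReal (cj ^ 2 * ca ^ 2) * (2 * ∫⁻ q, ENNReal.ofReal (E0 q ^ 16) ∂π + ∫⁻ q, ENNReal.ofReal (Es q ^ 16) ∂π +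
          ∫⁻ q, ENNReal.ofReal (Es' q ^ 16) ∂π) := by
        rw [lintegral_const_mul _ m123, lintegral_add_right _ m3, lintegral_add_right _ m2, lintegral_const_mul _ m1]
    _ ≤ ENNReal.ofReal (cj ^ 2 * ca ^ 2) * (2 * ENNReal.ofReal K + ENNReal.ofReal K + ENNReal.ofReal K) :=
        mul_le_mul' le_rfl (add_le_add (add_le_add (mul_le_mul' le_rfl h0) hs) hs')
    _ = ENNReal.ofReal (4 * cj ^ 2 * ca ^ 2 * K) := by
        rw [← ENNReal.ofReal_ofNat, ← ENNReal.ofReal_mul zero_le_two, ← ENNReal.ofReal_add (by positivity) hK0,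
          ← ENNReal.ofReal_add (by positivity) hK0, ← ENNReal.ofReal_mul (by positivity)]
        congr 1; ring

include hω hl hβ hγ hT in
/-- **The squared prefactor.**  For `N ≥ 2`, the contact site `i₀ = 0`, a genuine bond `(k, k+1)` and a real time `r`, the
prefactor `G = c_j |a₀(x)| 2|p_0(x)| E_k(Φ_r x)² E_k(Φ_r x^{0})²` (`c_j = 7 + 15β`, `a₀ = p_0 ∂_{q_0}H`) satisfies
`∫⁻ G² dπ ≤ 4 c_j² c_a² K` (`c_a = ω₂ + 2lam + 2 + 5β`, `K` the bond-scalar moment bound): `|a₀| ≤ c_a E_0(x)³`, `|p_0| ≤ E_0(x)`,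
and the three stationary sixteenth moments (`lintegral_prefactor_sq_le_abstract`). -/
theorem lintegral_prefactor_sq_le {K : ℝ}
    (hK : ∀ (N : ℕ) (k l : Fin N) (a : ℕ), a ≤ 16 →
      Integrable (fun z : PhaseSpace N => (1 + z.1 k ^ 2 + z.1 l ^ 2 + z.2 k ^ 2 + z.2 l ^ 2) ^ a) ((pinnedChain ω₂ lam β γ).gibbsMeasure N T) ∧
      ∫ z, (1 + z.1 k ^ 2 + z.1 l ^ 2 + z.2 k ^ 2 + z.2 l ^ 2) ^ a ∂((pinnedChain ω₂ lam β γ).gibbsMeasure N T) ≤ K)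
    {N : ℕ} (hN : 0 < N) (hN2 : 2 ≤ N) (k : Fin N) (hk : k.val + 1 < N) (r : ℝ) :
    ∫⁻ q, ENNReal.ofReal (((7 + 15 * β) * |q.1.2 ⟨0, hN⟩ * partialQ ⟨0, hN⟩ ((pinnedChain ω₂ lam β γ).hamiltonian N) q.1| *
        (2 * |q.1.2 ⟨0, hN⟩|) *
        (1 + ((pinnedChain ω₂ lam β γ).solMap N T T r q.1 (pairPath q.2)).1 k ^ 2 +
          ((pinnedChain ω₂ lam β γ).solMap N T T r q.1 (pairPath q.2)).1 ⟨k.val + 1, hk⟩ ^ 2 +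
          ((pinnedChain ω₂ lam β γ).solMap N T T r q.1 (pairPath q.2)).2 k ^ 2 +
          ((pinnedChain ω₂ lam β γ).solMap N T T r q.1 (pairPath q.2)).2 ⟨k.val + 1, hk⟩ ^ 2) ^ 2 *
        (1 + ((pinnedChain ω₂ lam β γ).solMap N T T r (momentumFlip ⟨0, hN⟩ q.1) (pairPath q.2)).1 k ^ 2 +
          ((pinnedChain ω₂ lam β γ).solMap N T T r (momentumFlip ⟨0, hN⟩ q.1) (pairPath q.2)).1 ⟨k.val + 1, hk⟩ ^ 2 +
          ((pinnedChain ω₂ lam β γ).solMap N T T r (momentumFlip ⟨0, hN⟩ q.1) (pairPath q.2)).2 k ^ 2 +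
          ((pinnedChain ω₂ lam β γ).solMap N T T r (momentumFlip ⟨0, hN⟩ q.1) (pairPath q.2)).2 ⟨k.val + 1, hk⟩ ^ 2) ^ 2) ^ 2)
        ∂(((pinnedChain ω₂ lam β γ).gibbsMeasure N T).prod wienerPair) ≤
      ENNReal.ofReal (4 * (7 + 15 * β) ^ 2 * (ω₂ + 2 * lam + 2 + 5 * β) ^ 2 * K) := by
  set P := pinnedChain ω₂ lam β γ with hP
  set μ := P.gibbsMeasure N T with hμ
  set π : Measure (PhaseSpace N × WienerPair) := μ.prod wienerPair with hπ
  set i0 : Fin N := ⟨0, hN⟩ with hi0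
  set i1 : Fin N := ⟨1, hN2⟩ with hi1
  set k1 : Fin N := ⟨k.val + 1, hk⟩ with hk1
  -- measurability of the two flows
  have hzm : Measurable fun q : PhaseSpace N × WienerPair => P.solMap N T T r q.1 (pairPath q.2) :=
    pinnedChain_measurable_solMap_pairPath hω hl hβ hγ N T T r
  have hΘm : Measurable fun q : PhaseSpace N × WienerPair => (momentumFlip i0 q.1, q.2) :=
    ((measurable_momentumFlip i0).comp measurable_fst).prodMk measurable_snd
  have hz'm : Measurable fun q : PhaseSpace N × WienerPair => P.solMap N T T r (momentumFlip i0 q.1) (pairPath q.2) := by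
    have h := hzm.comp hΘm; exact h
  have hEc : Continuous fun z : PhaseSpace N => 1 + z.1 k ^ 2 + z.1 k1 ^ 2 + z.2 k ^ 2 + z.2 k1 ^ 2 := by fun_prop
  have hE0m : Measurable fun q : PhaseSpace N × WienerPair =>
      1 + q.1.1 i0 ^ 2 + q.1.1 i1 ^ 2 + q.1.2 i0 ^ 2 + q.1.2 i1 ^ 2 :=
    ((by fun_prop : Continuous fun z : PhaseSpace N => 1 + z.1 i0 ^ 2 + z.1 i1 ^ 2 + z.2 i0 ^ 2 + z.2 i1 ^ 2).measurable).comp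
      measurable_fst
  have hEsm := hEc.measurable.comp hzm
  have hEs'm := hEc.measurable.comp hz'm
  -- the three moments
  obtain ⟨h0, -, -⟩ := lintegral_bondScalar_pow_le hω hl hβ hγ hT hK hN i0 i1 i0 r (a := 16) le_rfl
  obtain ⟨-, hs, hs'⟩ := lintegral_bondScalar_pow_le hω hl hβ hγ hT hK hN k k1 i0 r (a := 16) le_rfl
  have hK0 : 0 ≤ K := by
    obtain ⟨-, hle⟩ := hK N k k1 0 (by norm_num)
    haveI : IsProbabilityMeasure μ := pinnedChain_isProbabilityMeasure_gibbsMeasure hω hl hβ γ N hT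
    simp at hle
    linarith
  exact lintegral_prefactor_sq_le_abstract π (cj := 7 + 15 * β) (ca := ω₂ + 2 * lam + 2 + 5 * β) (by positivity)
    (by positivity) hK0
    (a := fun q : PhaseSpace N × WienerPair => q.1.2 i0 * partialQ i0 (P.hamiltonian N) q.1)
    (p := fun q : PhaseSpace N × WienerPair => q.1.2 i0)
    (E0 := fun q : PhaseSpace N × WienerPair => 1 + q.1.1 i0 ^ 2 + q.1.1 i1 ^ 2 + q.1.2 i0 ^ 2 + q.1.2 i1 ^ 2)
    (Es := fun q : PhaseSpace N × WienerPair => 1 + (P.solMap N T T r q.1 (pairPath q.2)).1 k ^ 2 +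
      (P.solMap N T T r q.1 (pairPath q.2)).1 k1 ^ 2 + (P.solMap N T T r q.1 (pairPath q.2)).2 k ^ 2 +
      (P.solMap N T T r q.1 (pairPath q.2)).2 k1 ^ 2)
    (Es' := fun q : PhaseSpace N × WienerPair => 1 + (P.solMap N T T r (momentumFlip i0 q.1) (pairPath q.2)).1 k ^ 2 +
      (P.solMap N T T r (momentumFlip i0 q.1) (pairPath q.2)).1 k1 ^ 2 +
      (P.solMap N T T r (momentumFlip i0 q.1) (pairPath q.2)).2 k ^ 2 +
      (P.solMap N T T r (momentumFlip i0 q.1) (pairPath q.2)).2 k1 ^ 2)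
    hE0m hEsm hEs'm (fun q => (bondScalar_bounds _ _ _ _).1) (fun q => by positivity) (fun q => by positivity)
    (fun q => abs_contactPower_le_scalar (γ := γ) hω.le hl hβ hN hN2 q.1)
    (fun q => (bondScalar_bounds (q.1.1 i0) (q.1.1 i1) (q.1.2 i0) (q.1.2 i1)).2.2.2.1) h0 hs hs'

/-- **Registered helper `helper_kdPrefactorMoments` (stub S, line `kick-dipole-no-collapse`): `N`-UNIFORM ANNEALED MOMENTS OF
THE LIGHT-CONE PREFACTOR** (closed form of `exists_bondScalar_moment_bound` + `lintegral_prefactor_sq_le`): one constant `K ≥ 1`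
bounds every Gibbs moment `∫ E_{k,l}^a dμ_T^N` (`a ≤ 16`, all `N`, all sites) and, through it, the squared prefactor
`G² = (c_j |a₀| 2|p_0| E_k(Φ_r x)² E_k(Φ_r x^0)²)²` under `μ_T ⊗ W`: `∫⁻ G² ≤ 4 c_j² c_a² K`. -/
theorem helper_kdPrefactorMoments : ∀ ω₂ lam β γ : ℝ, 0 < ω₂ → 0 ≤ lam → 0 ≤ β → 0 ≤ γ → ∀ T : ℝ, 0 < T → ∃ K : ℝ, 1 ≤ K ∧ (∀ (N : ℕ) (k l : Fin N) (a : ℕ), a ≤ 16 → Integrable (fun z : PhaseSpace N => (1 + z.1 k ^ 2 + z.1 l ^ 2 + z.2 k ^ 2 + z.2 l ^ 2) ^ a) ((pinnedChain ω₂ lam β γ).gibbsMeasure N T) ∧ ∫ z, (1 + z.1 k ^ 2 + z.1 l ^ 2 + z.2 k ^ 2 + z.2 l ^ 2) ^ a ∂((pinnedChain ω₂ lam β γ).gibbsMeasure N T) ≤ K) ∧ ∀ (N : ℕ) (hN : 0 < N) (hN2 : 2 ≤ N) (k : Fin N) (hk : k.val + 1 < N) (r : ℝ), ∫⁻ q,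 ENNReal.ofReal (((7 + 15 * β) * |q.1.2 ⟨0, hN⟩ * partialQ ⟨0, hN⟩ ((pinnedChain ω₂ lam β γ).hamiltonian N) q.1| * (2 * |q.1.2 ⟨0, hN⟩|) * (1 + ((pinnedChain ω₂ lam β γ).solMap N T T r q.1 (pairPath q.2)).1 k ^ 2 + ((pinnedChain ω₂ lam β γ).solMap N T T r q.1 (pairPath q.2)).1 ⟨k.val + 1, hk⟩ ^ 2 + ((pinnedChain ω₂ lam β γ).solMap N T T r q.1 (pairPath q.2)).2 k ^ 2 + ((pinnedChain ω₂ lam β γ).solMap N T T r q.1 (pairPath q.2)).2 ⟨k.val + 1, hk⟩ ^ 2) ^ 2 * (1 + ((pinnedChain ω₂ lam β γ).solMap N T T r (momentumFlip ⟨0, hN⟩ q.1) (pairPath q.2)).1 k ^ 2 + ((pinnedChain ω₂ lam β γ).solMap N T T r (momentumFlip ⟨0, hN⟩ q.1) (pairPath q.2)).1 ⟨k.val + 1, hk⟩ ^ 2 + ((pinnedChain ω₂ lam β γ).solMap N T T r (momentumFlip ⟨0, hN⟩ q.1) (pairPath q.2)).2 k ^ 2 + ((pinnedChain ω₂ lam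 β γ).solMap N T T r (momentumFlip ⟨0, hN⟩ q.1) (pairPath q.2)).2 ⟨k.val + 1, hk⟩ ^ 2) ^ 2) ^ 2) ∂(((pinnedChain ω₂ lam β γ).gibbsMeasure N T).prod wienerPair) ≤ ENNReal.ofReal (4 * (7 + 15 * β) ^ 2 * (ω₂ + 2 * lam + 2 + 5 * β) ^ 2 * K) := by
  intro ω₂ lam β γ hω hl hβ hγ T hT
  obtain ⟨K, hK1, hK⟩ := exists_bondScalar_moment_bound hω hl hβ hT
  exact ⟨K, hK1, hK, fun N hN hN2 k hk r => lintegral_prefactor_sq_le hω hl hβ hγ hT hK hN hN2 k hk r⟩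

end Summit.AtomisticToContinuum.FouriersLaw.Cruxes.ConductanceLowerBound.KickDipoleNoCollapse

end
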